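import Summits.Ventures.PercRepro2.CaseOneStarCertT1
import Summits.Ventures.PercRepro2.CaseOneGadgetUWA1BBlockII0
import Summits.Ventures.PercRepro2.CaseOneGadgetUWA1BBlockII1
import Summits.Ventures.PercRepro2.CaseOneGadgetUWA1BBlockII2
import Summits.Ventures.PercRepro2.CaseOneGadgetUWA1BBlockII3
import Summits.Ventures.PercRepro2.CaseOneGadgetUWA1BBlockII4
import Summits.Ventures.PercRepro2.CaseOneGadgetUWA1BBlockII5
import Summits.Ventures.PercRepro2.CaseOneGadgetUWA1BBlockII6
import Summits.Ventures.PercRepro2.CaseOneGadgetUWA1BBlockII7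
import Summits.Ventures.PercRepro2.CaseOneGadgetUWA1BBlockII8
import Summits.Ventures.PercRepro2.CaseOneGadgetUWA1BBlockII9
import Summits.Ventures.PercRepro2.CaseOneGadgetUWA1BBlockII10
import Summits.Ventures.PercRepro2.CaseOneGadgetUWA1BBlockII11
import Summits.Ventures.PercRepro2.CaseOneGadgetUWA1BBlockII12
import Summits.Ventures.PercRepro2.CaseOneGadgetUWA1BBlockII13
import Summits.Ventures.PercRepro2.CaseOneGadgetUWA1BBlockII14
import Summits.Ventures.PercRepro2.CaseOneStarFactsB

/-!
# The gadget `u ~ {w, a₁, b}`, `w ~ {u, a₂, o}` (uwa1b): the cell certificates of `iiAB5` (part 24e)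
(blind cell PercRepro2, p1 g34; the fourth gadget anchor of the six-form calculus — all six forms of the uwa1b gadget
as plain SFacts-cone certificate chains, generated by mining/p1/g34/uwa1b/genu.py = p1 g33's gent_uwa1.py / g25's
geno.py re-targeted; P1-G33 §6–§6″, P1-G34)

Each `eBABII ijk kl` is a nonnegative combination of `(pairwise atom) × (cell)` and cubic cell monomials — or, for the degree-4 ones, `M × eBABII ijk kl` (`M = Σ cᵢ` the total cell mass) is a nonnegative combination of `(atom) × (cell) × (cell)` and quartic cell monomials, then `SFacts.nonneg_of_sum_mul` (`CaseOneStarCertT1`) — exact LP certificates (kit j318477, every certificate re-verified exactly; data/p1/g33/gcerts_ii_uwa1b.json, form `ii`), here as exact `linear_combination`s over `SFacts` (the rational coefficients cleared by their common denominator). -/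

namespace Summit.Ventures.PercRepro2

namespace CaseOne

section CertABII24e
variable {R : Type*} [Field R] [LinearOrder R] [IsStrictOrderedRing R]

set_option maxHeartbeats 0 in
/-- `eBABII13323 ≥ 0`: the combination is identically zero (`ring`). -/
lemma eBABII13323_nonneg (m : SCells R) (_hf : SFactsB m) : 0 ≤ eBABII13323 m := by
  have h : eBABII13323 m = 0 := by
    unfold eBABII13323 cBABII00123 cBABII00223 cBABII01023 cBABII01123 cBABII01223 cBABII01323 cBABII02023 cBABII02123 cBABII02223 cBABII02323 cBABII03123 cBABII03223 cBABII03323 cBABII10023 cBABII10123 cBABII10223 cBABII10323 cBABII11023 cBABII11123 cBABII11223 cBABII11323 cBABII12023 cBABII12123 cBABII12223 cBABII12323 cBABII13023 cBABII13123 cBABII13223 cBABII13323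
    ring
  linarith [h]

set_option maxHeartbeats 0 in
/-- `eBABII13330 ≥ 0`: the combination is identically zero (`ring`). -/
lemma eBABII13330_nonneg (m : SCells R) (_hf : SFactsB m) : 0 ≤ eBABII13330 m := by
  have h : eBABII13330 m = 0 := by
    unfold eBABII13330 cBABII00130 cBABII00230 cBABII01030 cBABII01130 cBABII01230 cBABII01330 cBABII02030 cBABII02130 cBABII02230 cBABII02330 cBABII03130 cBABII03230 cBABII03330 cBABII10130 cBABII10230 cBABII10330 cBABII11030 cBABII11130 cBABII11230 cBABII11330 cBABII12030 cBABII12130 cBABII12230 cBABII12330 cBABII13030 cBABII13130 cBABII13230 cBABII13330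
    ring
  linarith [h]

end CertABII24e

end CaseOne

end Summit.Ventures.PercRepro2
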